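/-
Copyright (c) 2026. All rights reserved.
Released under Apache 2.0 license as described in the file LICENSE.
Authors: abc-iut cell — seat abc-iut-f-107 (F fact-proving wave, tranche 107: FACT-LIST rows F-0189 / F-0191 / F-0192,
conditional half; the negative half is `TPairsSchemaNegative.lean`, the model-witness half `TPairsTrivialContext.lean`).
-/
import Literature.AnabelianGeometry.AbsoluteAnabelian.TPairs
import Literature.AnabelianGeometry.AbsoluteAnabelian.GaloisTheatersTrivialContext
import HarnessLib

/-!
# [AbsTopIII] Cor 5.2 (iii), (iv): `ReferencePairIsoUnique`, `TPairHomDeterminedByTheaterHom`, `TPairIsoCanonical`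
# discharged CONDITIONALLY from the inputs print's argument names

S. Mochizuki, *Topics in absolute anabelian geometry III: global reconstruction algorithms*, J. Math. Sci. Univ.
Tokyo 22 (2015) 939–1156 [MochizukiAbsTopIII2015]; locators `p.N` = pages of the author's manuscript (cell render
`AbsTopIII-kurims-url-5493eb38cbb7`): Def 3.1 (ii) p. 67, Prop 3.2 (iv) p. 72, Def 4.1 (i)–(ii) pp. 101–102,
Def 5.1 (v) p. 117, Rmk 5.1.1 p. 118, Cor 5.2 (iii) p. 119, (iv) pp. 119–120.

`TPairs.lean` (abc-iut-L4-t3) types Cor 5.2 (iii)/(iv) as NAMED `Prop` FACTS parametrised by a context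
`R : GlobalAnabelianContext` and a vocabulary `W : TPairVocabulary R T` — an axiom-free interface whose predicates
("continuous action", "is an MLF-Galois `T`-pair", "is an Aut-holomorphic `T`-pair") and canonical data are free —
each docstring saying "assumption on `(R, W)`".  Their universal closures are FALSE (`TPairsSchemaNegative.lean`:
`not_forall_tPairIsoCanonical`, `not_forall_referencePairIsoUnique`, `not_forall_tPairHomDeterminedByTheaterHom`) and
they hold at a degenerate vocabulary (`TPairsTrivialContext.lean`).  This PROOF-ONLY file (no `def` / `instance` /
`structure` / notation) supplies the third kind of kernel knowledge about the rows, in the pattern of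
`GaloisTheatersRmk511.lean` (F-0109/F-0110/F-0111): the typed facts FOLLOW, for EVERY context and vocabulary, from the
primitive inputs print's own argument invokes, stated as hypotheses (laws) on `(R, W)`:

* `TPairVocabulary.tPairIsoCanonical_of_descent` — **F-0192**, Cor 5.2 (iv) (essential surjectivity of
  `An⊚[Th⊚_T] → Th⊚_T`) ⇐ `k_NF(𝟙_Π) = id` (functoriality of `k_NF(−)` at identities, the law
  `theaterIsoCanonical_of_mapKNF_id` uses for Cor 5.2 (i); observation I-L4-t3-1) ∧ the three DEFINITIONAL descent laws:
  "is an MLF-Galois `T`-pair" descends along isomorphisms of pairs (Def 3.1 (ii) p. 67: the notion IS "isomorphic to a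
  model pair"), "is an Aut-holomorphic `T`-pair" descends along Kummer transport (Def 4.1 (ii) (c) p. 102: idem),
  "continuous action" descends along equivariant isomorphisms.  So the refutation of the universal closure
  (`TPairsSchemaNegative`: a "continuity" predicate reading a free tag) used ONLY the non-invariance of a free predicate:
  modulo invariance, the reference isomorphisms of Def 5.1 (v) ARE a morphism `M⊚_T(Π) → M⊚` over `𝟙_Π`.
* `TPairVocabulary.referencePairIsoUnique_of_rigid` — **F-0189**, Cor 5.2 (iii) ("the reference isomorphisms
  `ψ⊚`, `{ψ_v}` are uniquely determined by the conditions stated in Definition 5.1, (v)") ⇐ four rigidity laws: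
  (L) Prop 3.2 (iv) p. 72 — an automorphism of an MLF-Galois `T`-pair acting trivially on the Galois group is the
  identity ("automorphisms of `(Π ↷ M_TM)` that act trivially on `Π` necessarily act trivially on `M_TM`"; print:
  `T ∈ {TF, TM}` — for `TLG` it fails by `x ↦ x⁻¹`, matching the row's side condition `T ≠ TLG`);
  (ρ) the restriction morphisms `{ρ_v}_{v ∈ V̄^non}` of a global `T`-pair are jointly monic (Def 5.1 (v) (d) p. 117:
  `ρ_v ≅ ρ_v(Π)`, induced by the field inclusion `k_NF(Π) ↪ k_NF(Π, v)`; `V(F)^non ≠ ∅`);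
  (X) Rmk 5.1.1 p. 118 — at an archimedean element "the isomorphism `ψ_v` is uniquely determined by the condition of
  compatibility with `δ_{ell,v_ell}`, `δ_v`" (Cor 2.3 (i)), typed at the level the interface records: two isomorphisms
  of structure-orbispaces compatible up to inner automorphism with the same `δ`-identifications induce the same field
  isomorphism `A_X ≅ A_Y` (functoriality of `A_(−)`, Cor 2.7 (e));
  (K) Def 4.1 (i)/(ii) pp. 101–102 — Kummer structures are injective (`κ_{M_k}` is the restriction of an isomorphism of
  topological fields `κ_k : k ⥲ A_X` to `M_k ⊆ k`) and their transport along `(i, ψ)` depends on `i` only through the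
  induced field isomorphism, so the transported Kummer structure pins `ψ`.
  Print's own route to `ψ⊚` is the functorial Kummer map of Cor 5.2 (iii) (not typed in `TPairs.lean`, RQ7 T1); the
  route here — local rigidity (L) + (ρ) — uses inputs print states elsewhere; both are recorded honestly as hypotheses.
* `TPairVocabulary.tPairHomDeterminedByTheaterHom_of_rigid` — **F-0191**, Cor 5.2 (iii) second sentence ("the
  isomorphisms `φ⊚`, `{φ_v}` … are uniquely determined by `φ_{V⊚}`") ⇐ the same four laws.
* **F-0190** `TPairEAHomExtends` (Cor 5.2 (iv), full faithfulness) has NO non-tautological conditional form over the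
  interface: extending a morphism of `EA⊚` to the canonical global `T`-pairs needs functoriality DATA of `M_{T⊚}(−)`,
  `M_T(−, v)` along morphisms of `EA⊚`, which `TPairVocabulary` does not carry (its closure is refuted in
  `TPairsEAHomExtendsNegative.lean`); nothing is filed for it here.

HONEST LABEL: the rows stay ASSUMPTIONS at the genuine `(R, W)` (étale `π₁`, [AbsTopIII] Thm 1.9 / Cor 1.10 /
Cor 2.8–2.9, Def 3.1 / 4.1 are not constructed in the tree — FOUNDATIONS row 12); what is kernel-checked is
«typed fact ⇐ print's named inputs», for every context and vocabulary.  Refereed pre-IUT anabelian geometry; nothing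
of [AbsTopIII] is asserted; nothing here bears on the disputed [IUTchIII] Cor. 3.12; a FACT row is an assumption
label, not an endorsement; typed ≠ proved.
-/

namespace Literature.AnabelianGeometry.AbsoluteAnabelian

open CategoryTheory Topology

universe u

section

variable {R : GlobalAnabelianContext.{u}} {T : TKind} (W : TPairVocabulary R T)

/-! ### F-0192: Cor 5.2 (iv), essential surjectivity, from functoriality at identities and the descent laws -/

/-- Transport of "is an MLF-Galois `T`-pair" between the actions of two EQUAL decomposition groups (closed subgroups
`S₁ = S₂` of the same `Π`) along an equivariant isomorphism of `T`-objects — the instance of the descent law of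
Def 3.1 (ii) at the identity isomorphism of Galois groups. [cite: MochizukiAbsTopIII2015, Def 3.1 (ii) p. 67] -/
private theorem isMLFGaloisPair_of_subgroup_eq
    (hM : ∀ {D D' : ProfiniteGrp.{u}} {M N : W.LocObj} (a : D →* Aut M) (b : D' →* Aut N)
      (e : D ≃ₜ* D') (ψ : M ≅ N), (∀ g, (a g).hom ≫ ψ.hom = ψ.hom ≫ (b (e g)).hom) →
      W.IsMLFGaloisPair b → W.IsMLFGaloisPair a)
    {G : ProfiniteGrp.{u}} {S₁ S₂ : Subgroup G} (hS : S₁ = S₂) (c₁ : IsClosed (S₁ : Set G))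
    (c₂ : IsClosed (S₂ : Set G)) {M N : W.LocObj} (a : ProfiniteGrp.ofClosedSubgroup ⟨S₁, c₁⟩ →* Aut M)
    (b : ProfiniteGrp.ofClosedSubgroup ⟨S₂, c₂⟩ →* Aut N) (ψ : M ≅ N)
    (heq : ∀ (g : G) (h₁ : g ∈ S₁) (h₂ : g ∈ S₂), (a ⟨g, h₁⟩).hom ≫ ψ.hom = ψ.hom ≫ (b ⟨g, h₂⟩).hom)
    (hb : W.IsMLFGaloisPair b) : W.IsMLFGaloisPair a := by
  subst hS
  exact hM a b (ContinuousMulEquiv.refl _) ψ (fun g => heq g.1 g.2 g.2) hb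

/-- **Cor 5.2 (iv), essential surjectivity of `An⊚[Th⊚_T] → Th⊚_T` (F-0192 `TPairIsoCanonical`), discharged from
functoriality of `k_NF(−)` at identities and the three definitional descent laws.**  For EVERY context `R` and
vocabulary `W`: if `k_NF(𝟙_Π) = id`, and the predicates "continuous action" (on `T⊚`-objects), "is an MLF-Galois
`T`-pair" (Def 3.1 (ii): "for some model MLF-Galois `T`-pair … there exist an isomorphism of topological groups
`Π_k ⥲ Π` and an isomorphism of objects `M_k ⥲ M` of `T` that are compatible with the respective actions" — hence
invariant under isomorphisms of pairs) and "is an Aut-holomorphic `T`-pair" (Def 4.1 (ii) (c), idem, under Kummer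
transport) DESCEND along isomorphisms, then for every global `T`-pair `M⊚` the reference isomorphisms `ψ_V`, `ψ⊚`,
`{ψ_v}` of Def 5.1 (v) constitute a morphism of global `T`-pairs `M⊚_T(Π) → M⊚` lying over `𝟙_Π`: conditions
(a)–(d) of a morphism over `𝟙_Π` are literally conditions (a)–(d) on the reference isomorphisms, and the canonical data
`(Π ↷ M_{T⊚}(Π))`, `(Π_v ↷ M_T(Π, v))`, `(X(Π, v) ↶κ M_T(Π, v))` inherit the three predicates from `M⊚` by descent.
The universal closure of the row is refuted ONLY through a non-invariant free predicate (`TPairsSchemaNegative`).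
The row stays an assumption at the genuine `(R, W)`. [cite: MochizukiAbsTopIII2015, Cor 5.2 (iv) p. 120] -/
theorem TPairVocabulary.tPairIsoCanonical_of_descent (hT : T ≠ .TLG)
    (hid : ∀ (E : FundamentalExtension.{u}) (x : R.kNF E), R.mapKNF (𝟙 E) (isEAHom_id E) x = x)
    (hC : ∀ {G : ProfiniteGrp.{u}} {M N : W.GlobObj} (a : G →* Aut M) (b : G →* Aut N) (ψ : M ≅ N),
      (∀ g, (a g).hom ≫ ψ.hom = ψ.hom ≫ (b g).hom) → W.IsContGlob b → W.IsContGlob a)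
    (hM : ∀ {D D' : ProfiniteGrp.{u}} {M N : W.LocObj} (a : D →* Aut M) (b : D' →* Aut N)
      (e : D ≃ₜ* D') (ψ : M ≅ N), (∀ g, (a g).hom ≫ ψ.hom = ψ.hom ≫ (b (e g)).hom) →
      W.IsMLFGaloisPair b → W.IsMLFGaloisPair a)
    (hA : ∀ {X Y : AutHolOrbispace.{u}} {M N : W.LocObj} (i : AutHolOrbispace.Iso X Y) (ψ : M ≅ N)
      (k : W.KummerStr X M), W.IsAutHolPair (W.kummerTransport i ψ k) → W.IsAutHolPair k) :
    TPairIsoCanonical W hT := by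
  intro P
  obtain ⟨ψV, hψV, hnon, harc, ψ, ψnon, ψarc, ha, hb, hc, hd, hd'⟩ := P.exists_reference
  -- along the `Π`-equivariant bijection `ψ_V`, decomposition groups correspond literally
  have hdec : ∀ v : (R.proVal P.theater.ext).carrier,
      (R.proVal P.theater.ext).decomp v = P.theater.V.decomp (ψV v) := fun v => by
    ext g
    simp only [GaloisProSet.decomp, MulAction.mem_stabilizer_iff]
    rw [← hψV.1, ψV.injective.eq_iff]
  -- the three predicates descend from `M⊚` to the canonical data `M⊚_T(Π)` along the reference isomorphisms
  have hc₀ : W.IsContGlob (W.globAct P.theater.ext) := hC (W.globAct _) P.act ψ ha P.isCont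
  have hM₀ : ∀ v : (R.proVal P.theater.ext).non, W.IsMLFGaloisPair (W.locAct P.theater.ext v) := fun v =>
    isMLFGaloisPair_of_subgroup_eq W hM (hdec v) ((R.proVal _).isClosed_decomp _)
      (P.theater.V.isClosed_decomp _) (W.locAct _ v) (P.actNon ⟨ψV v, hnon v⟩) (ψnon v)
      (fun g h₁ h₂ => hb v g h₁ h₂) (P.isMLF _)
  have hA₀ : ∀ v : (R.proVal P.theater.ext).arc, W.IsAutHolPair (W.locKummer P.theater.ext v) := fun v => by
    obtain ⟨ψv, -, -, hk⟩ := hc v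
    exact hA ψv (ψarc v) (W.locKummer _ v) (by rw [hk]; exact P.isAutHol _)
  -- the reference isomorphisms ARE a morphism `M⊚_T(Π) → M⊚` over `𝟙_Π` (once `k_NF(𝟙_Π) = id`)
  have harch : ∀ (v : (R.proVal P.theater.ext).arc) (hv : ψV v ∈ P.theater.V.arc),
      ∃ φv : AutHolOrbispace.Iso (R.archSpace P.theater.ext v) (P.theater.X ⟨ψV v, hv⟩),
        IsHomeomorph φv.fieldIso ∧
        InnerCompatible (fun a : P.theater.ext.geom => φv.pi1Iso (R.δell P.theater.ext v a))
          (P.theater.δ ⟨ψV v, hv⟩)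
          (fun a => ⟨(𝟙 P.theater.ext : P.theater.ext ⟶ P.theater.ext).arith a,
            (isEAHom_id P.theater.ext).bijOn_geom.mapsTo a.2⟩) ∧
        ∀ x : R.kNF P.theater.ext, P.theater.κ ⟨ψV v, hv⟩
          (R.mapKNF (𝟙 P.theater.ext) (isEAHom_id P.theater.ext) x) = φv.fieldIso (R.κell P.theater.ext v x) :=
    fun v hv => by
      obtain ⟨ψv, hhomeo, ⟨c, hc'⟩, hκ⟩ := hψV.2.2.2.2 v hv
      exact ⟨ψv, hhomeo, ⟨c, fun a => hc' a⟩, fun x => by rw [hid]; exact hκ x⟩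
  have hkum : ∀ v : (R.proVal P.theater.ext).arc,
      ∃ φv : AutHolOrbispace.Iso (R.archSpace P.theater.ext v) (P.theater.X ⟨ψV v, harc v⟩),
        InnerCompatible (fun a : P.theater.ext.geom => φv.pi1Iso (R.δell P.theater.ext v a))
          (P.theater.δ ⟨ψV v, harc v⟩)
          (fun a => ⟨(𝟙 P.theater.ext : P.theater.ext ⟶ P.theater.ext).arith a,
            (isEAHom_id P.theater.ext).bijOn_geom.mapsTo a.2⟩) ∧
        (∀ x : R.kNF P.theater.ext, P.theater.κ ⟨ψV v, harc v⟩
          (R.mapKNF (𝟙 P.theater.ext) (isEAHom_id P.theater.ext) x) = φv.fieldIso (R.κell P.theater.ext v x)) ∧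
        W.kummerTransport φv (ψarc v) (W.locKummer P.theater.ext v) = P.kummer ⟨ψV v, harc v⟩ := fun v => by
    obtain ⟨ψv, ⟨c, hc'⟩, hκ, hk⟩ := hc v
    exact ⟨ψv, ⟨c, fun a => hc' a⟩, fun x => by rw [hid]; exact hκ x, hk⟩
  exact ⟨hc₀, hM₀, hA₀,
    { φV := { φgrp := 𝟙 _
              isEAHom := isEAHom_id _
              φV := ψV
              φV_smul := hψV.1
              φV_generic := hψV.2.1
              image_non := hψV.2.2.1
              image_arc := hψV.2.2.2.1
              arch_compat := harch }
      φM := ψ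
      φM_equivariant := fun g => ha g
      non_mem := hnon
      arc_mem := harc
      φnon := ψnon
      φnon_equivariant := fun v g hg hg' => hb v g hg hg'
      φarc := ψarc
      φarc_kummer := hkum
      ρnon_comm := hd
      ρarc_comm := hd' }, rfl⟩

/-! ### F-0189 / F-0191: Cor 5.2 (iii), uniqueness, from the four rigidity laws -/

/-- **Cor 5.2 (iii), first sentence (F-0189 `ReferencePairIsoUnique`): "the reference isomorphisms `ψ⊚`, `{ψ_v}` of
Definition 5.1, (v), are uniquely determined by the conditions stated in Definition 5.1, (v)" — discharged, for EVERY
context and vocabulary, from four rigidity laws print names:** (L) Prop 3.2 (iv) — an automorphism of an MLF-Galois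
`T`-pair that is the identity on the Galois group is the identity ("automorphisms of `(Π ↷ M_TM)` that act trivially on
`Π` necessarily act trivially on `M_TM`"; `T ∈ {TF, TM}`); (ρ) the restriction morphisms `{ρ_v}_{v ∈ V̄^non}` of a global
`T`-pair are jointly monic (`ρ_v ≅ ρ_v(Π)` is induced by `k_NF(Π) ↪ k_NF(Π, v)`); (X) Rmk 5.1.1 — at archimedean `v`
"the isomorphism `ψ_v` is uniquely determined by the condition of compatibility with `δ_{ell,v_ell}`, `δ_v`", read at the
level of the induced field isomorphisms `A_{X(Π,v)} ≅ A_{X_v}`; (K) Def 4.1 (i)/(ii) — Kummer structures are injective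
and their transport depends on the orbispace isomorphism only through the induced field isomorphism.  Route: `ψ_v`
(`v` nonarchimedean) by (L) applied to `ψ_v⁻¹ ∘ ψ'_v`; `ψ⊚` by (ρ) and condition (d); `ψ_v` (`v` archimedean) by (X)
then (K) and condition (c).  Print's own route to `ψ⊚` is the functorial Kummer map of Cor 5.2 (iii) (not typed);
the laws are hypotheses, the row stays an assumption at the genuine `(R, W)`.
[cite: MochizukiAbsTopIII2015, Cor 5.2 (iii) p. 119] -/
theorem TPairVocabulary.referencePairIsoUnique_of_rigid (hT : T ≠ .TLG)
    (hL : ∀ {D : ProfiniteGrp.{u}} {M : W.LocObj} (act : D →* Aut M), W.IsMLFGaloisPair act →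
      ∀ α : M ≅ M, (∀ g, (act g).hom ≫ α.hom = α.hom ≫ (act g).hom) → α = Iso.refl M)
    (hρ : ∀ (P : GlobalTPair W) {A : W.GlobObj} (f g : A ⟶ P.M),
      (∀ w : P.theater.V.non, f ≫ P.ρnon w = g ≫ P.ρnon w) → f = g)
    (hX : ∀ {X Y : AutHolOrbispace.{u}} {Δ₁ Δ₂ : Type u} [Group Δ₁] [TopologicalSpace Δ₁]
      [Group Δ₂] [TopologicalSpace Δ₂] (δ₁ : Δ₁ ≃ₜ* X.pi1Hat) (δ₂ : Δ₂ ≃ₜ* Y.pi1Hat) (e : Δ₁ → Δ₂),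
      Function.Bijective e → ∀ i i' : AutHolOrbispace.Iso X Y,
      InnerCompatible (fun a => i.pi1Iso (δ₁ a)) δ₂ e → InnerCompatible (fun a => i'.pi1Iso (δ₁ a)) δ₂ e →
      i.fieldIso = i'.fieldIso)
    (hK : ∀ {X Y : AutHolOrbispace.{u}} {M N : W.LocObj} (i i' : AutHolOrbispace.Iso X Y) (ψ ψ' : M ≅ N)
      (k : W.KummerStr X M), i.fieldIso = i'.fieldIso →
      W.kummerTransport i ψ k = W.kummerTransport i' ψ' k → W.IsAutHolPair (W.kummerTransport i ψ k) → ψ = ψ') :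
    ReferencePairIsoUnique W hT := by
  intro P ψV hψV hnon harc ψ ψ' ψnon ψnon' ψarc ψarc' href href'
  obtain ⟨ha, hb, hc, hd, hd'⟩ := href
  obtain ⟨ha', hb', hc', he, he'⟩ := href'
  have hdec : ∀ v : (R.proVal P.theater.ext).carrier,
      (R.proVal P.theater.ext).decomp v = P.theater.V.decomp (ψV v) := fun v => by
    ext g
    simp only [GaloisProSet.decomp, MulAction.mem_stabilizer_iff]
    rw [← hψV.1, ψV.injective.eq_iff]
  -- (b) + (L): the nonarchimedean reference isomorphisms agree
  have h1 : ψnon = ψnon' := by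
    funext v
    have hβ := hL (P.actNon ⟨ψV v, hnon v⟩) (P.isMLF _) ((ψnon v).symm ≪≫ ψnon' v) (fun g => ?_)
    · have h := congrArg Iso.hom hβ
      simp only [Iso.trans_hom, Iso.symm_hom, Iso.refl_hom] at h
      ext
      simpa using ((Iso.inv_comp_eq _).mp h).symm
    · obtain ⟨g, hg'⟩ := g
      have hg : g ∈ (R.proVal P.theater.ext).decomp (v : (R.proVal P.theater.ext).carrier) := by
        rw [hdec]; exact hg'
      simp only [Iso.trans_hom, Iso.symm_hom]
      have e1 : (P.actNon ⟨ψV v, hnon v⟩ ⟨g, hg'⟩).hom ≫ (ψnon v).inv =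
          (ψnon v).inv ≫ (W.locAct _ v ⟨g, hg⟩).hom := by
        rw [Iso.comp_inv_eq, Category.assoc, Iso.eq_inv_comp]; exact (hb v g hg hg').symm
      rw [← Category.assoc, e1, Category.assoc, hb' v g hg hg', Category.assoc]
  -- (d) + (ρ): the global reference isomorphisms agree
  have h2 : ψ = ψ' := by
    ext
    apply hρ P
    rintro ⟨w, hw⟩
    obtain ⟨v, hv, rfl⟩ : w ∈ ψV '' (R.proVal P.theater.ext).non := by rw [hψV.2.2.1]; exact hw
    have e1 := hd ⟨v, hv⟩
    have e2 := he ⟨v, hv⟩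
    rw [← h1] at e2
    exact e1.symm.trans e2
  -- (c) + (X) + (K): the archimedean reference isomorphisms agree
  have h3 : ψarc = ψarc' := by
    funext v
    obtain ⟨i, hδ, -, hk⟩ := hc v
    obtain ⟨i', hδ', -, hk'⟩ := hc' v
    have hf : i.fieldIso = i'.fieldIso :=
      hX (R.δell _ v) (P.theater.δ _) id Function.bijective_id i i' hδ hδ'
    exact hK i i' (ψarc v) (ψarc' v) (W.locKummer _ v) hf (hk.trans hk'.symm) (by rw [hk]; exact P.isAutHol _)
  exact ⟨h2, h1, h3⟩

/-- **Cor 5.2 (iii), second sentence (F-0191 `TPairHomDeterminedByTheaterHom`): "the isomorphisms `φ⊚`, `{φ_v}` that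
appear in the definition of a morphism `φ` of global `T`-pairs in Definition 5.1, (v), are uniquely determined by
`φ_{V⊚}`" — discharged, for EVERY context and vocabulary, from the same four rigidity laws** (L) Prop 3.2 (iv),
(ρ) joint monicity of the restriction morphisms, (X) Rmk 5.1.1 (archimedean `φ_v` determined by `δ`-compatibility, at
the level of induced field isomorphisms), (K) Def 4.1 injectivity of Kummer structures.  Route: `φ_{v₁}`
(nonarchimedean) by (L) applied to `φ_{v₁} ∘ φ'_{v₁}⁻¹`, an automorphism of the MLF-Galois `T`-pair
`((Π₁)_{v₁} ↷ (M₁)_{v₁})` by condition (b) and `φ_Π((Π₁)_{v₁}) ⊆ (Π₂)_{v₂}`; `φ⊚` by (ρ), condition (d) and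
`φ_V(V̄^non₁) = V̄^non₂`; `φ_{v₁}` (archimedean) by (X) with `e := φ_Π|_Δ` (a bijection `Δ₁ ⥲ Δ₂`), then (K) and
condition (c).  The laws are hypotheses; the row stays an assumption at the genuine `(R, W)`.
[cite: MochizukiAbsTopIII2015, Cor 5.2 (iii) p. 119] -/
theorem TPairVocabulary.tPairHomDeterminedByTheaterHom_of_rigid (hT : T ≠ .TLG)
    (hL : ∀ {D : ProfiniteGrp.{u}} {M : W.LocObj} (act : D →* Aut M), W.IsMLFGaloisPair act →
      ∀ α : M ≅ M, (∀ g, (act g).hom ≫ α.hom = α.hom ≫ (act g).hom) → α = Iso.refl M)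
    (hρ : ∀ (P : GlobalTPair W) {A : W.GlobObj} (f g : A ⟶ P.M),
      (∀ w : P.theater.V.non, f ≫ P.ρnon w = g ≫ P.ρnon w) → f = g)
    (hX : ∀ {X Y : AutHolOrbispace.{u}} {Δ₁ Δ₂ : Type u} [Group Δ₁] [TopologicalSpace Δ₁]
      [Group Δ₂] [TopologicalSpace Δ₂] (δ₁ : Δ₁ ≃ₜ* X.pi1Hat) (δ₂ : Δ₂ ≃ₜ* Y.pi1Hat) (e : Δ₁ → Δ₂),
      Function.Bijective e → ∀ i i' : AutHolOrbispace.Iso X Y,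
      InnerCompatible (fun a => i.pi1Iso (δ₁ a)) δ₂ e → InnerCompatible (fun a => i'.pi1Iso (δ₁ a)) δ₂ e →
      i.fieldIso = i'.fieldIso)
    (hK : ∀ {X Y : AutHolOrbispace.{u}} {M N : W.LocObj} (i i' : AutHolOrbispace.Iso X Y) (ψ ψ' : M ≅ N)
      (k : W.KummerStr X M), i.fieldIso = i'.fieldIso →
      W.kummerTransport i ψ k = W.kummerTransport i' ψ' k → W.IsAutHolPair (W.kummerTransport i ψ k) → ψ = ψ') :
    TPairHomDeterminedByTheaterHom W hT := by
  intro P₁ P₂ φ φ' hV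
  obtain ⟨φV, φM, hMe, nm, am, φn, hne, φa, hak, hρn, hρa⟩ := φ
  obtain ⟨φV', φM', hMe', nm', am', φn', hne', φa', hak', hρn', hρa'⟩ := φ'
  cases hV
  -- (b) + (L): the nonarchimedean components agree
  have h1 : φn = φn' := by
    funext v
    have hβ := hL (P₁.actNon v) (P₁.isMLF v) (φn v ≪≫ (φn' v).symm) (fun g => ?_)
    · have h := congrArg Iso.hom hβ
      simp only [Iso.trans_hom, Iso.symm_hom, Iso.refl_hom] at h
      ext
      simpa using (Iso.comp_inv_eq _).mp h
    · obtain ⟨g, hg⟩ := g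
      have hg₂ : φV.φgrp.arith g ∈ P₂.theater.V.decomp (φV.φV v) := φV.map_decomp_le v ⟨g, hg, rfl⟩
      simp only [Iso.trans_hom, Iso.symm_hom]
      have e1 : (P₂.actNon ⟨φV.φV v, nm' v⟩ ⟨φV.φgrp.arith g, hg₂⟩).hom ≫ (φn' v).inv =
          (φn' v).inv ≫ (P₁.actNon v ⟨g, hg⟩).hom := by
        rw [Iso.comp_inv_eq, Category.assoc, Iso.eq_inv_comp]; exact (hne' v g hg hg₂).symm
      rw [← Category.assoc, hne v g hg hg₂, Category.assoc, e1, Category.assoc]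
  -- (d) + (ρ): the global components agree
  have h2 : φM = φM' := by
    ext
    apply hρ P₂
    rintro ⟨w, hw⟩
    obtain ⟨v, hv, rfl⟩ : w ∈ φV.φV '' P₁.theater.V.non := by rw [φV.image_non]; exact hw
    have e1 := hρn ⟨v, hv⟩
    have e2 := hρn' ⟨v, hv⟩
    rw [← h1] at e2
    exact e1.symm.trans e2
  -- (c) + (X) + (K): the archimedean components agree
  have h3 : φa = φa' := by
    funext v
    obtain ⟨i, hδ, -, hk⟩ := hak v
    obtain ⟨i', hδ', -, hk'⟩ := hak' v
    have hf : i.fieldIso = i'.fieldIso :=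
      hX (P₁.theater.δ v) (P₂.theater.δ _)
        (fun a => ⟨φV.φgrp.arith a, φV.isEAHom.bijOn_geom.mapsTo a.2⟩)
        φV.isEAHom.bijOn_geom.bijective i i' hδ hδ'
    exact hK i i' (φa v) (φa' v) (P₁.kummer v) hf (hk.trans hk'.symm) (by rw [hk]; exact P₂.isAutHol _)
  subst h1 h2 h3
  exact ⟨rfl, HEq.rfl, HEq.rfl⟩

end

end Literature.AnabelianGeometry.AbsoluteAnabelian
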